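import Mathlib
import HarnessLib
import Literature.Computability.AlgebraicComplexity.RealTauKnownCases
import Summits.ValiantsHypothesis.ValiantsHypothesis.Theorems.LacunarySymmetroidMatrixDescartesOsculationLawStubRankOne

/-!
# ValiantsHypothesis / LacunarySymmetroid — crux `MatrixDescartes` (stmt-ValiantsHypothesis-18050, V1),
# line `Cruxes/MatrixDescartes/Lines/osculation_law.lean` («osculation-law»): the `(2,K)` rank-one rung of the osculation count

The line's format-level LAW is `OsculationLaw : ∃ C, ∀ m K, OsculationLawAt m K (2^{C (K + log₂² m)})`, where
`OsculationLawAt m K B` says: for every block splitting `m = r + s` and every symmetric block pencil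
`G(t) = Σ_l t^{d_l} S_l` on `Fin r ⊕ Fin s`, if the osculation set of the spectral curve `det(G(t) + b·(I_r ⊕ 0)) = 0`
(the points `t > 0, b > 0` of the curve where the bordered log-Hessian vanishes) is finite, it has at most `B`
points.  The critics' upgrade condition (b) asks for an exponent-robust located rung at `m = 2`.

This file proves the **`r = s = 1` splitting of the `m = 2` rung with an explicit polynomial ceiling**:

  `osculationLawAt_two_rankOne : … (osculationSet d S).Finite → (osculationSet d S).ncard ≤ 16 · K ^ 6`

for every `K`, every exponent vector `d : Fin K → ℕ` and every block pencil `S : Fin K → Matrix (Fin 1 ⊕ Fin 1) …`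
(the line's vocabulary UNFOLDED verbatim, as in `…OsculationLawStubRankOne`).  Proof: by the landed stub
`OsculationRankOne.stub_rankOne` (p597803) the count is at most `Z₊mult(R)`, `R = W(f)·a² − W(a)·f²` with
`f = det G` (a `2 × 2` determinant of `K`-nomials: `≤ 2K²` monomials, via `Matrix.det_fin_two` after reindexing
`Fin 1 ⊕ Fin 1 ≃ Fin 2`), `a = det G₂₂` (`≤ K` monomials) and `W(h) = h·θ²h − (θh)²`, `θ = X·d/dX` (support of
`θh` inside the support of `h`); hence `R` has at most `4·|f|²·|a|² ≤ 16 K⁶` monomials and Descartes' rule of signs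
WITH multiplicity (Mathlib `Polynomial.roots_countP_pos_le_signVariations` + the tree's
`signVariations_lt_card_support`) bounds `Z₊mult(R)`.

Honest framing.  This is TWO of the THREE splittings of `OsculationLawAt 2 K (16 K^6)`: the `r = 0` splitting is
vacuous (the insertion polynomial is then `b`-free, so a finite osculation set is empty) and is not spelled out;
the `r = 2` splitting (cusps of `b² + tr G·b + det G`, a resultant modulo a monic quadratic) is NOT proved here.
The ceiling `16 K⁶` is a Descartes ceiling, not the instrument's conjectured `4K` (row R1).  Nothing here bears
on `OsculationLaw` for general `m`, on `PeelInequality`, on `MatrixDescartes`, on Conjecture B or on `VP ≠ VNP`,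
all OPEN.  No definitions, no named facts.
-/

-- `Summit.ValiantsHypothesis.ValiantsHypothesis.…` is the tree's mandated single-conjunct layout (Sub = Summit).
set_option linter.dupNamespace false

noncomputable section

namespace Summit.ValiantsHypothesis.ValiantsHypothesis.Theorems.LacunarySymmetroidMatrixDescartes

open Polynomial Matrix Finset
open scoped BigOperators

namespace OsculationRankOne

/-! ### Monomial counts -/

/-- `θ = X·d/dX` does not enlarge the support. [folklore] -/
theorem card_support_X_mul_derivative_le (p : ℝ[X]) :
    (X * derivative p).support.card ≤ p.support.card := by
  apply Finset.card_le_card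
  intro n hn
  rw [mem_support_iff] at hn ⊢
  cases n with
  | zero => simp at hn
  | succ n =>
    rw [coeff_X_mul, coeff_derivative] at hn
    intro h
    apply hn
    rw [h, zero_mul]

/-- Monomial count of a difference. [folklore] -/
theorem card_support_sub_le (p q : ℝ[X]) : (p - q).support.card ≤ p.support.card + q.support.card := by
  rw [sub_eq_add_neg]
  calc (p + -q).support.card ≤ (p.support ∪ (-q).support).card := Finset.card_le_card support_add
    _ ≤ p.support.card + (-q).support.card := Finset.card_union_le _ _
    _ = p.support.card + q.support.card := by rw [support_neg]

/-- The logarithmic Wronskian `W(h) = h·θ²h − (θh)²` has at most `2|h|²` monomials. [folklore] -/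
theorem card_support_logWronskian_le (h : ℝ[X]) :
    (h * (X * derivative (X * derivative h)) - (X * derivative h) ^ 2).support.card ≤
      2 * h.support.card ^ 2 := by
  have h1 := card_support_X_mul_derivative_le h
  have h2 : (X * derivative (X * derivative h)).support.card ≤ h.support.card :=
    (card_support_X_mul_derivative_le _).trans h1
  have hA : (h * (X * derivative (X * derivative h))).support.card ≤ h.support.card * h.support.card :=
    card_support_mul_le.trans (Nat.mul_le_mul_left _ h2)
  have hB : ((X * derivative h) ^ 2).support.card ≤ h.support.card * h.support.card := by
    rw [sq]
    exact card_support_mul_le.trans (Nat.mul_le_mul h1 h1)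
  calc _ ≤ _ := card_support_sub_le _ _
    _ ≤ h.support.card * h.support.card + h.support.card * h.support.card := Nat.add_le_add hA hB
    _ = 2 * h.support.card ^ 2 := by ring

/-- `R = W(f)a² − W(a)f²` has at most `4|f|²|a|²` monomials. [folklore] -/
theorem card_support_R_le (f a : ℝ[X]) :
    ((f * (X * derivative (X * derivative f)) - (X * derivative f) ^ 2) * a ^ 2
        - (a * (X * derivative (X * derivative a)) - (X * derivative a) ^ 2) * f ^ 2).support.card ≤
      4 * f.support.card ^ 2 * a.support.card ^ 2 := by
  have hf := card_support_logWronskian_le f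
  have ha := card_support_logWronskian_le a
  have hf2 : (f ^ 2).support.card ≤ f.support.card ^ 2 := by
    rw [sq, sq]; exact card_support_mul_le
  have ha2 : (a ^ 2).support.card ≤ a.support.card ^ 2 := by
    rw [sq, sq]; exact card_support_mul_le
  calc _ ≤ _ := card_support_sub_le _ _
    _ ≤ 2 * f.support.card ^ 2 * a.support.card ^ 2 + 2 * a.support.card ^ 2 * f.support.card ^ 2 :=
        Nat.add_le_add (card_support_mul_le.trans (Nat.mul_le_mul hf ha2))
          (card_support_mul_le.trans (Nat.mul_le_mul ha hf2))
    _ = 4 * f.support.card ^ 2 * a.support.card ^ 2 := by ring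

/-- An entry of the pencil `Σ_l X^{d_l} • S_l` is a `K`-nomial. [folklore] -/
theorem card_support_pencil_apply_le {ι : Type*} [Fintype ι] [DecidableEq ι] {K : ℕ} (d : Fin K → ℕ)
    (S : Fin K → Matrix ι ι ℝ) (i j : ι) :
    ((∑ l, (X : ℝ[X]) ^ d l • (S l).map Polynomial.C) i j).support.card ≤ K := by
  have hentry : (∑ l, (X : ℝ[X]) ^ d l • (S l).map Polynomial.C) i j = ∑ l, Polynomial.C (S l i j) * X ^ d l := by
    simp only [Matrix.sum_apply, Matrix.smul_apply, Matrix.map_apply, smul_eq_mul]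
    exact Finset.sum_congr rfl fun l _ => mul_comm _ _
  rw [hentry]
  calc _ ≤ ∑ l : Fin K, (Polynomial.C (S l i j) * X ^ d l).support.card :=
        Literature.Computability.AlgebraicComplexity.card_support_sum_le Finset.univ
          (fun l => Polynomial.C (S l i j) * X ^ d l)
    _ ≤ ∑ _l : Fin K, 1 :=
        Finset.sum_le_sum (f := fun l => (Polynomial.C (S l i j) * X ^ d l).support.card) (g := fun _ => 1)
          fun l _ => card_support_C_mul_X_pow_le_one
    _ = K := by simp

/-- `det G₂₂` (a `1 × 1` determinant) is a `K`-nomial. [folklore] -/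
theorem card_support_lowerDet_le {K : ℕ} (d : Fin K → ℕ) (S : Fin K → Matrix (Fin 1 ⊕ Fin 1) (Fin 1 ⊕ Fin 1) ℝ) :
    (∑ l, (X : ℝ[X]) ^ d l • ((S l).toBlocks₂₂).map Polynomial.C).det.support.card ≤ K := by
  rw [Matrix.det_unique]
  exact card_support_pencil_apply_le d (fun l => (S l).toBlocks₂₂) default default

/-- `det G` (a `2 × 2` determinant of `K`-nomials) has at most `2K²` monomials. [folklore] -/
theorem card_support_blockDet_le {K : ℕ} (d : Fin K → ℕ) (S : Fin K → Matrix (Fin 1 ⊕ Fin 1) (Fin 1 ⊕ Fin 1) ℝ) :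
    (∑ l, (X : ℝ[X]) ^ d l • (S l).map Polynomial.C).det.support.card ≤ 2 * K ^ 2 := by
  set M : Matrix (Fin 1 ⊕ Fin 1) (Fin 1 ⊕ Fin 1) ℝ[X] := ∑ l, (X : ℝ[X]) ^ d l • (S l).map Polynomial.C with hM
  have hE : ∀ i j, (M i j).support.card ≤ K := fun i j => card_support_pencil_apply_le d S i j
  let e : Fin 1 ⊕ Fin 1 ≃ Fin 2 := finSumFinEquiv
  have hdet : M.det = (Matrix.reindex e e M).det := (Matrix.det_reindex_self e M).symm
  rw [hdet, Matrix.det_fin_two]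
  simp only [Matrix.reindex_apply, Matrix.submatrix_apply]
  calc _ ≤ _ := card_support_sub_le _ _
    _ ≤ K * K + K * K := Nat.add_le_add (card_support_mul_le.trans (Nat.mul_le_mul (hE _ _) (hE _ _)))
        (card_support_mul_le.trans (Nat.mul_le_mul (hE _ _) (hE _ _)))
    _ = 2 * K ^ 2 := by ring

/-- Descartes with multiplicity: the positive roots of `P`, counted with multiplicity, are fewer than its
monomials. [folklore: Descartes' rule of signs] -/
theorem card_roots_filter_pos_le_card_support (P : ℝ[X]) :
    Multiset.card (P.roots.filter (fun t => 0 < t)) ≤ P.support.card := by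
  by_cases hP : P = 0
  · simp [hP]
  rw [← Multiset.countP_eq_card_filter]
  exact (P.roots_countP_pos_le_signVariations).trans
    (Literature.Computability.AlgebraicComplexity.signVariations_lt_card_support hP).le


/-! ### The `(2,K)` rank-one rung -/

/-- **The `r = s = 1` splitting of `OsculationLawAt 2 K (16 K^6)`.**  For every `K`, every exponent vector `d` and
every block pencil `S : Fin K → Matrix (Fin 1 ⊕ Fin 1) (Fin 1 ⊕ Fin 1) ℝ`: if the osculation set of the spectral curve
`det(Σ_l t^(d l) S_l + b·(I₁ ⊕ 0)) = 0` in the open quadrant (the line's `osculationSet d S`, UNFOLDED verbatim) is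
finite, it has at most `16 K^6` points.  (The symmetry hypothesis is idle, as in `stub_rankOne`.) -/
theorem osculationLawAt_two_rankOne (K : ℕ) (d : Fin K → ℕ) (S : Fin K → Matrix (Fin 1 ⊕ Fin 1) (Fin 1 ⊕ Fin 1) ℝ)
    (hS : ∀ l, (S l).IsSymm)
    (hfin : {p : Fin 2 → ℝ | 0 < p 0 ∧ 0 < p 1 ∧ MvPolynomial.eval p (∑ l, (MvPolynomial.X (0 : Fin 2) : MvPolynomial (Fin 2) ℝ) ^ d l •
              (S l).map (MvPolynomial.C : ℝ →+* MvPolynomial (Fin 2) ℝ)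
            + (MvPolynomial.X (1 : Fin 2) : MvPolynomial (Fin 2) ℝ) •
              (Matrix.fromBlocks 1 0 0 0 : Matrix (Fin 1 ⊕ Fin 1) (Fin 1 ⊕ Fin 1) ℝ).map
                (MvPolynomial.C : ℝ →+* MvPolynomial (Fin 2) ℝ)).det = 0 ∧
      MvPolynomial.eval p
        (MvPolynomial.X 0 * MvPolynomial.pderiv 0 (MvPolynomial.X 0 * MvPolynomial.pderiv 0 (∑ l, (MvPolynomial.X (0 : Fin 2) : MvPolynomial (Fin 2) ℝ) ^ d l •
              (S l).map (MvPolynomial.C : ℝ →+* MvPolynomial (Fin 2) ℝ)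
            + (MvPolynomial.X (1 : Fin 2) : MvPolynomial (Fin 2) ℝ) •
              (Matrix.fromBlocks 1 0 0 0 : Matrix (Fin 1 ⊕ Fin 1) (Fin 1 ⊕ Fin 1) ℝ).map
                (MvPolynomial.C : ℝ →+* MvPolynomial (Fin 2) ℝ)).det)
            * (MvPolynomial.X 1 * MvPolynomial.pderiv 1 (∑ l, (MvPolynomial.X (0 : Fin 2) : MvPolynomial (Fin 2) ℝ) ^ d l •
              (S l).map (MvPolynomial.C : ℝ →+* MvPolynomial (Fin 2) ℝ)
            + (MvPolynomial.X (1 : Fin 2) : MvPolynomial (Fin 2) ℝ) •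
              (Matrix.fromBlocks 1 0 0 0 : Matrix (Fin 1 ⊕ Fin 1) (Fin 1 ⊕ Fin 1) ℝ).map
                (MvPolynomial.C : ℝ →+* MvPolynomial (Fin 2) ℝ)).det) ^ 2
          - 2 * (MvPolynomial.X 0 * MvPolynomial.pderiv 0 (MvPolynomial.X 1 * MvPolynomial.pderiv 1 (∑ l, (MvPolynomial.X (0 : Fin 2) : MvPolynomial (Fin 2) ℝ) ^ d l •
              (S l).map (MvPolynomial.C : ℝ →+* MvPolynomial (Fin 2) ℝ)
            + (MvPolynomial.X (1 : Fin 2) : MvPolynomial (Fin 2) ℝ) •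
              (Matrix.fromBlocks 1 0 0 0 : Matrix (Fin 1 ⊕ Fin 1) (Fin 1 ⊕ Fin 1) ℝ).map
                (MvPolynomial.C : ℝ →+* MvPolynomial (Fin 2) ℝ)).det))
            * (MvPolynomial.X 0 * MvPolynomial.pderiv 0 (∑ l, (MvPolynomial.X (0 : Fin 2) : MvPolynomial (Fin 2) ℝ) ^ d l •
              (S l).map (MvPolynomial.C : ℝ →+* MvPolynomial (Fin 2) ℝ)
            + (MvPolynomial.X (1 : Fin 2) : MvPolynomial (Fin 2) ℝ) •
              (Matrix.fromBlocks 1 0 0 0 : Matrix (Fin 1 ⊕ Fin 1) (Fin 1 ⊕ Fin 1) ℝ).map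
                (MvPolynomial.C : ℝ →+* MvPolynomial (Fin 2) ℝ)).det) * (MvPolynomial.X 1 * MvPolynomial.pderiv 1 (∑ l, (MvPolynomial.X (0 : Fin 2) : MvPolynomial (Fin 2) ℝ) ^ d l •
              (S l).map (MvPolynomial.C : ℝ →+* MvPolynomial (Fin 2) ℝ)
            + (MvPolynomial.X (1 : Fin 2) : MvPolynomial (Fin 2) ℝ) •
              (Matrix.fromBlocks 1 0 0 0 : Matrix (Fin 1 ⊕ Fin 1) (Fin 1 ⊕ Fin 1) ℝ).map
                (MvPolynomial.C : ℝ →+* MvPolynomial (Fin 2) ℝ)).det)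
          + MvPolynomial.X 1 * MvPolynomial.pderiv 1 (MvPolynomial.X 1 * MvPolynomial.pderiv 1 (∑ l, (MvPolynomial.X (0 : Fin 2) : MvPolynomial (Fin 2) ℝ) ^ d l •
              (S l).map (MvPolynomial.C : ℝ →+* MvPolynomial (Fin 2) ℝ)
            + (MvPolynomial.X (1 : Fin 2) : MvPolynomial (Fin 2) ℝ) •
              (Matrix.fromBlocks 1 0 0 0 : Matrix (Fin 1 ⊕ Fin 1) (Fin 1 ⊕ Fin 1) ℝ).map
                (MvPolynomial.C : ℝ →+* MvPolynomial (Fin 2) ℝ)).det)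
            * (MvPolynomial.X 0 * MvPolynomial.pderiv 0 (∑ l, (MvPolynomial.X (0 : Fin 2) : MvPolynomial (Fin 2) ℝ) ^ d l •
              (S l).map (MvPolynomial.C : ℝ →+* MvPolynomial (Fin 2) ℝ)
            + (MvPolynomial.X (1 : Fin 2) : MvPolynomial (Fin 2) ℝ) •
              (Matrix.fromBlocks 1 0 0 0 : Matrix (Fin 1 ⊕ Fin 1) (Fin 1 ⊕ Fin 1) ℝ).map
                (MvPolynomial.C : ℝ →+* MvPolynomial (Fin 2) ℝ)).det) ^ 2) = 0}.Finite) :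
    {p : Fin 2 → ℝ | 0 < p 0 ∧ 0 < p 1 ∧ MvPolynomial.eval p (∑ l, (MvPolynomial.X (0 : Fin 2) : MvPolynomial (Fin 2) ℝ) ^ d l •
              (S l).map (MvPolynomial.C : ℝ →+* MvPolynomial (Fin 2) ℝ)
            + (MvPolynomial.X (1 : Fin 2) : MvPolynomial (Fin 2) ℝ) •
              (Matrix.fromBlocks 1 0 0 0 : Matrix (Fin 1 ⊕ Fin 1) (Fin 1 ⊕ Fin 1) ℝ).map
                (MvPolynomial.C : ℝ →+* MvPolynomial (Fin 2) ℝ)).det = 0 ∧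
      MvPolynomial.eval p
        (MvPolynomial.X 0 * MvPolynomial.pderiv 0 (MvPolynomial.X 0 * MvPolynomial.pderiv 0 (∑ l, (MvPolynomial.X (0 : Fin 2) : MvPolynomial (Fin 2) ℝ) ^ d l •
              (S l).map (MvPolynomial.C : ℝ →+* MvPolynomial (Fin 2) ℝ)
            + (MvPolynomial.X (1 : Fin 2) : MvPolynomial (Fin 2) ℝ) •
              (Matrix.fromBlocks 1 0 0 0 : Matrix (Fin 1 ⊕ Fin 1) (Fin 1 ⊕ Fin 1) ℝ).map
                (MvPolynomial.C : ℝ →+* MvPolynomial (Fin 2) ℝ)).det)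
            * (MvPolynomial.X 1 * MvPolynomial.pderiv 1 (∑ l, (MvPolynomial.X (0 : Fin 2) : MvPolynomial (Fin 2) ℝ) ^ d l •
              (S l).map (MvPolynomial.C : ℝ →+* MvPolynomial (Fin 2) ℝ)
            + (MvPolynomial.X (1 : Fin 2) : MvPolynomial (Fin 2) ℝ) •
              (Matrix.fromBlocks 1 0 0 0 : Matrix (Fin 1 ⊕ Fin 1) (Fin 1 ⊕ Fin 1) ℝ).map
                (MvPolynomial.C : ℝ →+* MvPolynomial (Fin 2) ℝ)).det) ^ 2
          - 2 * (MvPolynomial.X 0 * MvPolynomial.pderiv 0 (MvPolynomial.X 1 * MvPolynomial.pderiv 1 (∑ l, (MvPolynomial.X (0 : Fin 2) : MvPolynomial (Fin 2) ℝ) ^ d l •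
              (S l).map (MvPolynomial.C : ℝ →+* MvPolynomial (Fin 2) ℝ)
            + (MvPolynomial.X (1 : Fin 2) : MvPolynomial (Fin 2) ℝ) •
              (Matrix.fromBlocks 1 0 0 0 : Matrix (Fin 1 ⊕ Fin 1) (Fin 1 ⊕ Fin 1) ℝ).map
                (MvPolynomial.C : ℝ →+* MvPolynomial (Fin 2) ℝ)).det))
            * (MvPolynomial.X 0 * MvPolynomial.pderiv 0 (∑ l, (MvPolynomial.X (0 : Fin 2) : MvPolynomial (Fin 2) ℝ) ^ d l •
              (S l).map (MvPolynomial.C : ℝ →+* MvPolynomial (Fin 2) ℝ)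
            + (MvPolynomial.X (1 : Fin 2) : MvPolynomial (Fin 2) ℝ) •
              (Matrix.fromBlocks 1 0 0 0 : Matrix (Fin 1 ⊕ Fin 1) (Fin 1 ⊕ Fin 1) ℝ).map
                (MvPolynomial.C : ℝ →+* MvPolynomial (Fin 2) ℝ)).det) * (MvPolynomial.X 1 * MvPolynomial.pderiv 1 (∑ l, (MvPolynomial.X (0 : Fin 2) : MvPolynomial (Fin 2) ℝ) ^ d l •
              (S l).map (MvPolynomial.C : ℝ →+* MvPolynomial (Fin 2) ℝ)
            + (MvPolynomial.X (1 : Fin 2) : MvPolynomial (Fin 2) ℝ) •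
              (Matrix.fromBlocks 1 0 0 0 : Matrix (Fin 1 ⊕ Fin 1) (Fin 1 ⊕ Fin 1) ℝ).map
                (MvPolynomial.C : ℝ →+* MvPolynomial (Fin 2) ℝ)).det)
          + MvPolynomial.X 1 * MvPolynomial.pderiv 1 (MvPolynomial.X 1 * MvPolynomial.pderiv 1 (∑ l, (MvPolynomial.X (0 : Fin 2) : MvPolynomial (Fin 2) ℝ) ^ d l •
              (S l).map (MvPolynomial.C : ℝ →+* MvPolynomial (Fin 2) ℝ)
            + (MvPolynomial.X (1 : Fin 2) : MvPolynomial (Fin 2) ℝ) •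
              (Matrix.fromBlocks 1 0 0 0 : Matrix (Fin 1 ⊕ Fin 1) (Fin 1 ⊕ Fin 1) ℝ).map
                (MvPolynomial.C : ℝ →+* MvPolynomial (Fin 2) ℝ)).det)
            * (MvPolynomial.X 0 * MvPolynomial.pderiv 0 (∑ l, (MvPolynomial.X (0 : Fin 2) : MvPolynomial (Fin 2) ℝ) ^ d l •
              (S l).map (MvPolynomial.C : ℝ →+* MvPolynomial (Fin 2) ℝ)
            + (MvPolynomial.X (1 : Fin 2) : MvPolynomial (Fin 2) ℝ) •
              (Matrix.fromBlocks 1 0 0 0 : Matrix (Fin 1 ⊕ Fin 1) (Fin 1 ⊕ Fin 1) ℝ).map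
                (MvPolynomial.C : ℝ →+* MvPolynomial (Fin 2) ℝ)).det) ^ 2) = 0}.ncard ≤ 16 * K ^ 6 := by
  refine (stub_rankOne 1 K d S hS hfin).trans ?_
  refine (card_roots_filter_pos_le_card_support _).trans ?_
  refine (card_support_R_le _ _).trans ?_
  have hf := card_support_blockDet_le d S
  have ha := card_support_lowerDet_le d S
  set F := (∑ l, (X : ℝ[X]) ^ d l • (S l).map Polynomial.C).det.support.card with hF
  set A := (∑ l, (X : ℝ[X]) ^ d l • ((S l).toBlocks₂₂).map Polynomial.C).det.support.card with hA
  calc 4 * F ^ 2 * A ^ 2 ≤ 4 * (2 * K ^ 2) ^ 2 * K ^ 2 := by gcongr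
    _ = 16 * K ^ 6 := by ring

end OsculationRankOne

end Summit.ValiantsHypothesis.ValiantsHypothesis.Theorems.LacunarySymmetroidMatrixDescartes
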